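import Summits.AtomisticToContinuum.Crystallization.Theorems.FrustratedLawDichotomyStrainedPatchCleanCollar

/-!
# The ELASTIC piece cut by DISTANCE TO THE HOMOGENEOUS INSTANCES: the knife-edge tube ∧ the off-tube clean textures («HomTube», lens-5 g45 §B; critic ROW 790 (4))

Second node of lens-5 g45, INSIDE the ELASTIC piece `CleanTextureFloor r` of «CleanCollar» (`…StrainedPatchCleanCollar`).  ROW 783 (3) parked the g44
ReliefSplit (R1 near-homogeneous relief ∧ R2 far floor, predicate `NearHom ε`) until the instrument ε_adm was measured; g45 measured it (memo §3(d),
`out/NEARHOM.md`): the knife-edge minimiser RD_jz0w52s IS the admissible cap-riding hcp floor instance HZ00 displaced by at most `2.53e-3` on the `63/10`-ball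
(relief `2.54e-4`), every admissible state on file with NEGATIVE relief lies within `ε* ≤ 4e-3` of its homogeneous reference, every admissible state with
`ε* ≥ 5e-3` sits ABOVE its reference (`+1.3e-5 … +1.8e-3`), and all admissible states have `ε* ≤ 1.5e-2` except two torsion textures (`ε* ≤ 0.061`,
`S ≥ 3.05e-3`).  ROW 790 (3)–(4) un-parked the split as the calibrated «HomTube» INSIDE [EL], with conditions: `NearHom` Prop-defined over tree vocabulary
(IsHomBall family + sup-displacement) — it is, verbatim the g44 sketch predicate; necessity of both tube pieces PROVED — below; the off-tube piece stated with an
EXPLICIT FLOOR `φ` so that census can kill it — below; must-fail probes — `g45/check/HomTubeProbes.lean`.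

* `NearHom ε z c` (g44): the `63/10`-ball of the cluster is, atom by atom and in position relative to the centre, within `ε` of the corresponding part of SOME
  ADMISSIBLE HOMOGENEOUS instance (`Admissible ∧ IsHomBall (133/10)`), by an injective correspondence covering the homogeneous ball shrunk by `ε`.  Monotone in `ε`.
* DIAL `ε` (tube radius; record `1/100`: `2.5×` the largest negative-relief displacement on file, inside the clean class since a hom instance has misfit
  `≤ .072` and `.072 + 2ε/d < 1/8`), inside the clean-collar dial `r` (record `63/10`).
* `TubeFloor r ε` **[TUBE: (H) + relief]** — the piece on admissible, clean-within-`r`, `NearHom ε` clusters;  `OffTubeFloor r ε φ` **[OFF-TUBE: quantitative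
  rigidity, census-killable]** — on admissible, clean-within-`r`, NOT-`NearHom ε` clusters the ball average is `≥ φ` (record `φ = 1/1000`: every off-tube admissible
  state on file has `S ≥ 2.09e-3`; necessity is proved for `φ = 0`, the `φ > 0` form is a deliberate, killable strengthening by the floor only).
* EXACT CUT `CleanTextureFloor r ↔ TubeFloor r ε ∧ OffTubeFloor r ε 0` (every `ε`; `em` on `NearHom ε`), necessity of both, seam for any `φ ≥ 0`, dial monotone
  (`TubeFloor` antitone in `ε`, `OffTubeFloor` monotone in `ε`, antitone in `φ`), SHELL LADDER `TubeFloor r ε₂ ↔ TubeFloor r ε₁ ∧ HomShellFloor r ε₁ ε₂`.  [PROVED]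
* SECOND LAYER under the tube: `TubeRelief r ε L B` = GEN 43H's relief (R) restricted to clean `NearHom ε` clusters (so (R) ⇒ CleanTextureRelief ⇒ TubeRelief, nothing
  lost); `HomFloor m → TubeRelief r ε L B → L·σ₁ + B ≤ m → TubeFloor r ε`.  Inside the tube the relief is a LINEAR-RESPONSE quantity about an admissible force-capped
  homogeneous instance at displacement `≤ ε` — the Lipschitz form ROW 790 (4) asks for is `TubeRelief r ε 0 B` (pure constant `B`, record `B = 1/1000 ≥ 4×` the measured
  `2.54e-4`, seam `B ≤ m = 1/625`).  [PROVED]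
* RECORD NODES: `HomFloor (1/625) → TubeRelief (63/10) (1/100) 0 (1/1000) → OffTubeFloor (63/10) (1/100) (1/1000) → AnnularDefectFloor (24/5) (63/10) →
  DefectiveCollarFloor (24/5) → StrainedPatchRec` (and `→ F1X∪T(0)` = `h1` of `…CollarCensusZeroFree.…_unionT_zero_free`), plus the `(1/12, 1/4000)` variant.  [PROVED]

TAGS.  TUBE `TubeFloor (63/10) (1/100)`: WEAKER (restriction of [EL]) · MECHANISM-NAMED ((H) certificate in flight + linear response under the force cap `σ₁`
inside a tube of radius `1/100` about an admissible homogeneous instance; g44 CERT-DESIGN D1–D6 with the tube constant sharpened from the crude `225·ε²` to the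
projected Hessian) · knife-edge (the record lives here).  OFF-TUBE `OffTubeFloor (63/10) (1/100) (1/1000)`: WEAKER-by-restriction at `φ = 0`, killable
strengthening at `φ = 1/1000` · UNDECIDED · test = census L5-ASK4 (admissible clean states with `ε* ∈ [4e-3, 3e-2]` and `S < 2.0e-3`; engine `nearhom45.py`).
HONESTY.  Again a case split whose content is WHERE it cuts (at the measured tube radius); `NearHom` is NOT locally decidable (an `∃` over instances and
correspondences) — the instrument `nearhom45.py` computes a certified UPPER bound for the least `ε` (any explicit fit) and the rms lower bound.  No new axioms, no sorry.
Evidence: `run/shared/lean/pub/decomp-a2c/decomp-a2c-lens-5/g45/{NODE-g45.md §3(d) §B, out/NEARHOM.md, scripts/nearhom45.py, check/HomTubeProbes.*}`.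
-/

namespace Summit.AtomisticToContinuum.Crystallization.Theorems.FrustratedLawDichotomyStrainedPatchHomTube

open scoped BigOperators Classical
open Summit.AtomisticToContinuum.Crystallization.Theorems.FrustratedLawDichotomyRangeCut
open Summit.AtomisticToContinuum.Crystallization.Theorems.FrustratedLawDichotomySchurCut
open Summit.AtomisticToContinuum.Crystallization.Theorems.FrustratedLawDichotomyMotifLemmas
open Summit.AtomisticToContinuum.Crystallization.Theorems.FrustratedLawDichotomyAveragingCut
open Summit.AtomisticToContinuum.Crystallization.Theorems.FrustratedLawDichotomyAveragingRuleCap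
open Summit.AtomisticToContinuum.Crystallization.Theorems.FrustratedLawDichotomyAveragingRuleTightFree
open Summit.AtomisticToContinuum.Crystallization.Theorems.FrustratedLawDichotomyExemptDoor (SitePred)
open Summit.AtomisticToContinuum.Crystallization.Theorems.FrustratedLawDichotomyExemptAbsorption
open Summit.AtomisticToContinuum.Crystallization.Theorems.FrustratedLawDichotomyExemptAbsorptionRecord
open Summit.AtomisticToContinuum.Crystallization.Theorems.FrustratedLawDichotomyCollarCensus
open Summit.AtomisticToContinuum.Crystallization.Theorems.FrustratedLawDichotomyCollarCensusKappa
open Summit.AtomisticToContinuum.Crystallization.Theorems.FrustratedLawDichotomyStrainedPatchHomSplit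
open Summit.AtomisticToContinuum.Crystallization.Theorems.FrustratedLawDichotomyStrainedPatchCleanCollar

/-! ## §1. The tube predicate (g44 sketch, verbatim semantics) -/

/-- **`NearHom ε z c`** (lens-5 g44): the `63/10`-ball of the cluster around its centre is, atom by atom, within `ε` (in position relative to the centre) of the
corresponding part of SOME admissible homogeneous instance — injective correspondence on the ball, covering the homogeneous ball shrunk by `ε`. -/
def NearHom (ε : ℝ) {M : ℕ} (z : Fin M → E3) (c : Fin M) : Prop :=
  ∃ (M₀ : ℕ) (z₀ : Fin M₀ → E3) (c₀ : Fin M₀) (e : Fin M → Fin M₀), Admissible M₀ z₀ c₀ ∧ IsHomBall (133 / 10) z₀ c₀ ∧ e c = c₀ ∧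
    (∀ a, dist (z a) (z c) ≤ 63 / 10 → dist (z a - z c) (z₀ (e a) - z₀ c₀) ≤ ε) ∧
    (∀ a b, dist (z a) (z c) ≤ 63 / 10 → dist (z b) (z c) ≤ 63 / 10 → e a = e b → a = b) ∧
    (∀ b₀, dist (z₀ b₀) (z₀ c₀) ≤ 63 / 10 - ε → ∃ a, dist (z a) (z c) ≤ 63 / 10 ∧ e a = b₀)

/-- The tube widens with `ε`. [folklore] -/
theorem NearHom.mono {ε ε' : ℝ} {M : ℕ} {z : Fin M → E3} {c : Fin M} (h : NearHom ε z c) (hle : ε ≤ ε') : NearHom ε' z c := by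
  obtain ⟨M₀, z₀, c₀, e, h₀, hhom, hc, hdisp, hinj, hcov⟩ := h
  refine ⟨M₀, z₀, c₀, e, h₀, hhom, hc, fun a ha => (hdisp a ha).trans hle, hinj, fun b₀ hb₀ => hcov b₀ ?_⟩
  linarith

/-! ## §2. The two pieces inside the clean class, the exact cut, necessity, seams, dials -/

/-- **`TubeFloor r ε` [TUBE — (H) + linear response; knife-edge]** — the piece on admissible clusters, clean within `r`, inside the `ε`-tube. -/
def TubeFloor (r ε : ℝ) : Prop :=
  ∀ (M : ℕ) (z : Fin M → E3) (c : Fin M), Admissible M z c → CleanBall r z c → NearHom ε z c → 0 ≤ ballAvg (9 / 5) z (xRec M z) c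

/-- **`OffTubeFloor r ε φ` [OFF-TUBE — quantitative rigidity; census-killable at `φ > 0`]** — on admissible clusters, clean within `r`, OUTSIDE the `ε`-tube,
the ball average is `≥ φ`. -/
def OffTubeFloor (r ε φ : ℝ) : Prop :=
  ∀ (M : ℕ) (z : Fin M → E3) (c : Fin M), Admissible M z c → CleanBall r z c → ¬NearHom ε z c → φ ≤ ballAvg (9 / 5) z (xRec M z) c

/-- **`HomShellFloor r ε₁ ε₂` [SHELL]** — the piece on admissible clean clusters inside the `ε₂`-tube but outside the `ε₁`-tube. -/
def HomShellFloor (r ε₁ ε₂ : ℝ) : Prop :=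
  ∀ (M : ℕ) (z : Fin M → E3) (c : Fin M), Admissible M z c → CleanBall r z c → ¬NearHom ε₁ z c → NearHom ε₂ z c →
    0 ≤ ballAvg (9 / 5) z (xRec M z) c

/-- ★ EXACT CUT of the elastic piece: `CleanTextureFloor r ↔ TubeFloor r ε ∧ OffTubeFloor r ε 0`. [folklore: `em` on `NearHom ε`] -/
theorem cleanTextureFloor_iff_tube_and_offTube (r ε : ℝ) : CleanTextureFloor r ↔ TubeFloor r ε ∧ OffTubeFloor r ε 0 := by
  constructor
  · intro h
    exact ⟨fun M z c hz hcl _ => h M z c hz hcl, fun M z c hz hcl _ => h M z c hz hcl⟩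
  · rintro ⟨hT, hO⟩ M z c hz hcl
    by_cases hn : NearHom ε z c
    · exact hT M z c hz hcl hn
    · exact hO M z c hz hcl hn

/-- NECESSITY: the tube piece is a restriction of the elastic piece. [folklore] -/
theorem tubeFloor_of_cleanTextureFloor {r : ℝ} (ε : ℝ) (h : CleanTextureFloor r) : TubeFloor r ε :=
  ((cleanTextureFloor_iff_tube_and_offTube r ε).1 h).1

/-- NECESSITY: the off-tube piece at floor `0` is a restriction of the elastic piece. [folklore] -/
theorem offTubeFloor_zero_of_cleanTextureFloor {r : ℝ} (ε : ℝ) (h : CleanTextureFloor r) : OffTubeFloor r ε 0 :=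
  ((cleanTextureFloor_iff_tube_and_offTube r ε).1 h).2

/-- NECESSITY of the shell piece. [folklore] -/
theorem homShellFloor_of_cleanTextureFloor {r : ℝ} (ε₁ ε₂ : ℝ) (h : CleanTextureFloor r) : HomShellFloor r ε₁ ε₂ :=
  fun M z c hz hcl _ _ => h M z c hz hcl

/-- The off-tube piece is antitone in the floor. [folklore] -/
theorem OffTubeFloor.of_le {r ε φ φ' : ℝ} (h : OffTubeFloor r ε φ) (hle : φ' ≤ φ) : OffTubeFloor r ε φ' :=
  fun M z c hz hcl hn => hle.trans (h M z c hz hcl hn)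

/-- ★ SEAM: `TubeFloor r ε → OffTubeFloor r ε φ → 0 ≤ φ → CleanTextureFloor r`. [folklore] -/
theorem cleanTextureFloor_of_tube_of_offTube {r ε φ : ℝ} (hT : TubeFloor r ε) (hO : OffTubeFloor r ε φ) (hφ : 0 ≤ φ) : CleanTextureFloor r :=
  (cleanTextureFloor_iff_tube_and_offTube r ε).2 ⟨hT, hO.of_le hφ⟩

/-- DIAL: the tube piece is antitone in `ε` (a wider tube is a stronger claim). [folklore] -/
theorem TubeFloor.of_le {r ε ε' : ℝ} (h : TubeFloor r ε') (hle : ε ≤ ε') : TubeFloor r ε :=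
  fun M z c hz hcl hn => h M z c hz hcl (hn.mono hle)

/-- DIAL: the off-tube piece is monotone in `ε` (a wider tube leaves less outside). [folklore] -/
theorem OffTubeFloor.mono {r ε ε' φ : ℝ} (h : OffTubeFloor r ε φ) (hle : ε ≤ ε') : OffTubeFloor r ε' φ :=
  fun M z c hz hcl hn => h M z c hz hcl fun hn' => hn (hn'.mono hle)

/-- DIAL (clean-collar radius): both pieces are monotone in `r` like `CleanTextureFloor`. [folklore] -/
theorem TubeFloor.of_le_radius {r r' ε : ℝ} (h : TubeFloor r ε) (hle : r ≤ r') : TubeFloor r' ε :=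
  fun M z c hz hcl hn => h M z c hz (hcl.mono hle) hn

/-- Monotonicity / transfer bookkeeping (`OffTubeFloor.of_le_radius`). -/
theorem OffTubeFloor.of_le_radius {r r' ε φ : ℝ} (h : OffTubeFloor r ε φ) (hle : r ≤ r') : OffTubeFloor r' ε φ :=
  fun M z c hz hcl hn => h M z c hz (hcl.mono hle) hn

/-- SHELL LADDER: `TubeFloor r ε₂ ↔ TubeFloor r ε₁ ∧ HomShellFloor r ε₁ ε₂` for `ε₁ ≤ ε₂`. [folklore] -/
theorem tubeFloor_iff_shell {r ε₁ ε₂ : ℝ} (hle : ε₁ ≤ ε₂) : TubeFloor r ε₂ ↔ TubeFloor r ε₁ ∧ HomShellFloor r ε₁ ε₂ := by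
  constructor
  · intro h
    exact ⟨h.of_le hle, fun M z c hz hcl _ hn₂ => h M z c hz hcl hn₂⟩
  · rintro ⟨hT, hS⟩ M z c hz hcl hn₂
    by_cases hn₁ : NearHom ε₁ z c
    · exact hT M z c hz hcl hn₁
    · exact hS M z c hz hcl hn₁ hn₂

/-- SHELL LADDER, off-tube side: `OffTubeFloor r ε₁ 0 ↔ OffTubeFloor r ε₂ 0 ∧ HomShellFloor r ε₁ ε₂` for `ε₁ ≤ ε₂`. [folklore] -/
theorem offTubeFloor_iff_shell {r ε₁ ε₂ : ℝ} (hle : ε₁ ≤ ε₂) : OffTubeFloor r ε₁ 0 ↔ OffTubeFloor r ε₂ 0 ∧ HomShellFloor r ε₁ ε₂ := by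
  constructor
  · intro h
    exact ⟨h.mono hle, fun M z c hz hcl hn₁ _ => h M z c hz hcl hn₁⟩
  · rintro ⟨hO, hS⟩ M z c hz hcl hn₁
    by_cases hn₂ : NearHom ε₂ z c
    · exact hS M z c hz hcl hn₁ hn₂
    · exact hO M z c hz hcl hn₂

/-! ## §3. Second layer under the tube: GEN 43H's relief restricted to the tube -/

/-- **`TubeRelief r ε L B` [linear response under the force cap, inside the tube]** — on admissible clusters, clean within `r` and `NearHom ε`, some admissible
homogeneous instance has ball average at most `L·σ₁ + B` above the cluster's. -/
def TubeRelief (r ε L B : ℝ) : Prop :=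
  ∀ (M : ℕ) (z : Fin M → E3) (c : Fin M), Admissible M z c → CleanBall r z c → NearHom ε z c →
    ∃ (M₀ : ℕ) (z₀ : Fin M₀ → E3) (c₀ : Fin M₀), Admissible M₀ z₀ c₀ ∧ IsHomBall (133 / 10) z₀ c₀ ∧
      ballAvg (9 / 5) z₀ (xRec M₀ z₀) c₀ - (L * sigmaOne + B) ≤ ballAvg (9 / 5) z (xRec M z) c

/-- The clean relief of «CleanCollar» gives the tube relief (so GEN 43H's (R) does too). [folklore] -/
theorem tubeRelief_of_cleanTextureRelief {r L B : ℝ} (ε : ℝ) (h : CleanTextureRelief r L B) : TubeRelief r ε L B :=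
  fun M z c hz hcl _ => h M z c hz hcl

/-- Monotonicity / transfer bookkeeping (`tubeRelief_of_textureReliefBound`). -/
theorem tubeRelief_of_textureReliefBound {L B : ℝ} (r ε : ℝ) (h : TextureReliefBound L B) : TubeRelief r ε L B :=
  tubeRelief_of_cleanTextureRelief ε (cleanTextureRelief_of_textureReliefBound r h)

/-- The tube relief is monotone in `(L, B)` and antitone in `ε`. [folklore] -/
theorem TubeRelief.mono {r ε L B L' B' : ℝ} (h : TubeRelief r ε L B) (hL : L ≤ L') (hB : B ≤ B') : TubeRelief r ε L' B' := by
  intro M z c hz hcl hn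
  obtain ⟨M₀, z₀, c₀, h₀, hhom, hle⟩ := h M z c hz hcl hn
  refine ⟨M₀, z₀, c₀, h₀, hhom, ?_⟩
  have hσ : 0 ≤ sigmaOne := by unfold sigmaOne; norm_num
  nlinarith

/-- Monotonicity / transfer bookkeeping (`TubeRelief.of_le`). -/
theorem TubeRelief.of_le {r ε ε' L B : ℝ} (h : TubeRelief r ε' L B) (hle : ε ≤ ε') : TubeRelief r ε L B :=
  fun M z c hz hcl hn => h M z c hz hcl (hn.mono hle)

/-- ★ SEAM under the tube: `HomFloor m → TubeRelief r ε L B → L·σ₁ + B ≤ m → TubeFloor r ε`. [folklore] -/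
theorem tubeFloor_of_homFloor_of_tubeRelief {m r ε L B : ℝ} (hH : HomFloor m) (hR : TubeRelief r ε L B) (hm : L * sigmaOne + B ≤ m) :
    TubeFloor r ε := by
  intro M z c hz hcl hn
  obtain ⟨M₀, z₀, c₀, h₀, hhom, hle⟩ := hR M z c hz hcl hn
  have := hH M₀ z₀ c₀ h₀ hhom
  linarith

/-- Where the tube relief sits: the tube piece and a witness instance give it back. [folklore] -/
theorem tubeRelief_of_tubeFloor_of_witness {r ε L B : ℝ} (h : TubeFloor r ε) {M₀ : ℕ} {z₀ : Fin M₀ → E3} {c₀ : Fin M₀}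
    (h₀ : Admissible M₀ z₀ c₀) (hhom : IsHomBall (133 / 10) z₀ c₀) (hval : ballAvg (9 / 5) z₀ (xRec M₀ z₀) c₀ ≤ L * sigmaOne + B) :
    TubeRelief r ε L B := by
  intro M z c hz hcl hn
  refine ⟨M₀, z₀, c₀, h₀, hhom, ?_⟩
  have := h M z c hz hcl hn
  linarith

/-! ## §4. The nodes (HomTube inside CleanCollar) -/

/-- ★ `HomFloor m → TubeRelief r ε L B → L·σ₁ + B ≤ m → OffTubeFloor r ε φ → 0 ≤ φ → CleanTextureFloor r`. [folklore] -/
theorem cleanTextureFloor_of_homFloor_of_tubeRelief_of_offTube {m r ε L B φ : ℝ} (hH : HomFloor m) (hR : TubeRelief r ε L B)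
    (hm : L * sigmaOne + B ≤ m) (hO : OffTubeFloor r ε φ) (hφ : 0 ≤ φ) : CleanTextureFloor r :=
  cleanTextureFloor_of_tube_of_offTube (tubeFloor_of_homFloor_of_tubeRelief hH hR hm) hO hφ

/-- ★★ THE NODE (four regimes): `TubeFloor (63/10) ε → OffTubeFloor (63/10) ε φ → 0 ≤ φ → AnnularDefectFloor (24/5) (63/10) → DefectiveCollarFloor (24/5) →
StrainedPatchRec`. [folklore] -/
theorem strainedPatchRec_of_tube_of_offTube_of_annular_of_near {ε φ : ℝ} (hT : TubeFloor (63 / 10) ε) (hO : OffTubeFloor (63 / 10) ε φ) (hφ : 0 ≤ φ)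
    (hA : AnnularDefectFloor (24 / 5) (63 / 10)) (hD : DefectiveCollarFloor (24 / 5)) : StrainedPatchRec :=
  strainedPatchRec_iff_record_regimes.2 ⟨cleanTextureFloor_of_tube_of_offTube hT hO hφ, hA, hD⟩

/-- Pure-constant seam arithmetic: `0·σ₁ + 1/1000 ≤ 1/625`. [formal bookkeeping] -/
theorem seam_arith_tube : 0 * sigmaOne + 1 / 1000 ≤ (1 : ℝ) / 625 := by norm_num

/-- ★★ RECORD NODE (Lipschitz form ROW 790 (4)): `HomFloor (1/625) → TubeRelief (63/10) (1/100) 0 (1/1000) → OffTubeFloor (63/10) (1/100) (1/1000) →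
AnnularDefectFloor (24/5) (63/10) → DefectiveCollarFloor (24/5) → StrainedPatchRec`. -/
theorem strainedPatchRec_of_homFloor_625_of_tubeRelief_milli_of_offTube_of_annular_of_near (hH : HomFloor (1 / 625))
    (hR : TubeRelief (63 / 10) (1 / 100) 0 (1 / 1000)) (hO : OffTubeFloor (63 / 10) (1 / 100) (1 / 1000))
    (hA : AnnularDefectFloor (24 / 5) (63 / 10)) (hD : DefectiveCollarFloor (24 / 5)) : StrainedPatchRec :=
  strainedPatchRec_of_tube_of_offTube_of_annular_of_near (tubeFloor_of_homFloor_of_tubeRelief hH hR seam_arith_tube) hO (by norm_num) hA hD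

/-- RECORD NODE, GEN 43H literals: `HomFloor (1/625) → TubeRelief (63/10) (1/100) (1/12) (1/4000) → OffTubeFloor (63/10) (1/100) (1/1000) → … → StrainedPatchRec`. -/
theorem strainedPatchRec_of_homFloor_625_of_tubeRelief_of_offTube_of_annular_of_near (hH : HomFloor (1 / 625))
    (hR : TubeRelief (63 / 10) (1 / 100) (1 / 12) (1 / 4000)) (hO : OffTubeFloor (63 / 10) (1 / 100) (1 / 1000))
    (hA : AnnularDefectFloor (24 / 5) (63 / 10)) (hD : DefectiveCollarFloor (24 / 5)) : StrainedPatchRec :=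
  strainedPatchRec_of_tube_of_offTube_of_annular_of_near (tubeFloor_of_homFloor_of_tubeRelief hH hR seam_arith) hO (by norm_num) hA hD

/-- ★★ … and as the `h1` hypothesis of `…CollarCensusZeroFree.aperiodicFrustratedLawGap_of_collarPiecesKK_milli_unionT_zero_free`. -/
theorem strainedPatch_of_homFloor_625_of_tubeRelief_milli_of_offTube_of_annular_of_near (hH : HomFloor (1 / 625))
    (hR : TubeRelief (63 / 10) (1 / 100) 0 (1 / 1000)) (hO : OffTubeFloor (63 / 10) (1 / 100) (1 / 1000))
    (hA : AnnularDefectFloor (24 / 5) (63 / 10)) (hD : DefectiveCollarFloor (24 / 5)) :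
    StrainedPatchMotifPricingCapXK (1 / 1000) (9 / 5) (133 / 10) (3 / 2) (effPot w₄₅ ω₄ (3 / 400)) (-(7175 / 10000) + 3 / 400)
      (Collar (9 / 2) fun N y j => (∃ s : ℝ, 0 ≤ s ∧ s ≤ 3 / 2 ∧ NonEquilibriumCore (-(7175 / 10000)) 0 7 s (1 / 10000) N y j) ∨
        GoodAtScale (1 / 20) (3 / 2) y j) :=
  strainedPatch_iff.1 (strainedPatchRec_of_homFloor_625_of_tubeRelief_milli_of_offTube_of_annular_of_near hH hR hO hA hD)

/-- Link to the g44 sketch: its unrestricted far floor `FarFloor ε` (target on `¬NearHom ε`, no clean hypothesis) gives the off-tube piece at floor `0` for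
every clean radius. [folklore] -/
theorem offTubeFloor_zero_of_far {r ε : ℝ}
    (hfar : ∀ (M : ℕ) (z : Fin M → E3) (c : Fin M), Admissible M z c → ¬NearHom ε z c → 0 ≤ ballAvg (9 / 5) z (xRec M z) c) :
    OffTubeFloor r ε 0 :=
  fun M z c hz _ hn => hfar M z c hz hn

end Summit.AtomisticToContinuum.Crystallization.Theorems.FrustratedLawDichotomyStrainedPatchHomTube
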